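import Literature.NumberTheory.ConnesConsani.ScalingSiteH0Levels
import HarnessLib

/-!
# The explicit parametrisation of the level sets `H⁰(D)^{p^m}` on `C_p` (Connes–Consani 2017, §5.4)

Topic `Literature/NumberTheory/ConnesConsani`, continuing `ScalingSitePeriodicOrbit.lean` (statement
layer: `CpDivisor`, `cpH0`, `CpH0Level`, named fact `ConnesConsani2017_thm_5_17`) and
`ScalingSiteH0Levels.lean` (slopes, break points based at `1`, `p`-adic size of slopes).
Everything here is PROVED; the definitions are the auxiliary objects of the proof of Thm. 5.17
(Riemann–Roch of type II on the periodic orbit), whose dimension count and assembly are carried out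
in `ScalingSiteRiemannRochProofs.lean`.

## Content (the mechanism of Lemmas 5.18–5.19, arXiv:1603.03191 pp. 19–21)

For `f ∈ H⁰(D)^{pᵐ}` the Frobenius-scaled function `pᵐ f` (Lemma 5.18 (ii)) has slopes in `ℤ` on
`[1, p)` (Prop. 5.15 (iv): `‖f‖_p ≤ pᵐ`); subtracting the FIXED concave piecewise affine function
`-Σ_μ k_μ (x - μ)₊`, `k_μ = ⌈pᵐ D(μ)/μ⌉`, `μ` running over the support of `D` inside `(1, p)` (the
translation of Lemma 5.18 (i)), makes it convex (this is `D + (f) ≥ 0` at the support points),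
hence of the normal form of Lemma 5.19 (i),(iii):
`F_{t,y}(x) = t - A (x - 1) + Σ_σ (x - y_σ)₊ - Σ_μ k_μ (x - μ)₊`, `x ∈ [1, p]`,
with SORTED break points `y_σ ∈ [1, p]` counted with multiplicity (`σ < M`) and `t = pᵐ f(1)`.
* `paramFun`, `paramElem`, `slopeAt`, `paramFun_affine`: the normal form and its integer slopes;
* `ParamValid` (the closed constraints: `y_σ ∈ [1, p]`, enough generators pinned at each support
  point, `F(p) = F(1)`, and the order condition at `1`, "`-f'₊(1) + p f'₋(p) ≤ N`" of Lemma 5.19 (i))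
  and `ParamValid.toLevel`: admissible parameters give elements of `H⁰(D)^{pᵐ}` (MEMBERSHIP);
* `RepData`, `exists_paramValid`: conversely every element of `H⁰(D)^{pᵐ}` is `p⁻ᵐ F_{t,y}` on
  `[1, p]` for monotone admissible parameters of the fixed sizes `A = bigA D m`, `M = bigM D m`
  (REPRESENTATION; the a priori slope bounds come from `D + (f) ≥ 0`, `f(p) = f(1)` and
  `Σ_j h_j (t_{j+1} - t_j) = 0`).

## References
* A. Connes, C. Consani, *Geometry of the scaling site*, Selecta Math. (N.S.) 23 (2017)
  1803–1850, §5.4, Lemmas 5.18, 5.19 [ConnesConsani2017ScalingSite].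
-/

noncomputable section

open Set Filter Topology

namespace Literature.NumberTheory.ConnesConsani

/-! ### The explicit parametrisation of `H⁰(D)^{p^m}` -/

section Param

variable {p : ℕ} [hp : Fact p.Prime]

/-- The support of `D` inside `(1, p)`, a finite set. [cite: ConnesConsani2017ScalingSite, Def. 5.3] -/
def suppFinset (D : CpDivisor p) : Finset ℝ :=
  D.finite_support.toFinset.filter (fun x => 1 < x)

omit hp in
/-- Membership in the support finset: the support points of `D` inside `(1, p)`. [cite: ConnesConsani2017ScalingSite, §5.2 (divisors: finite support in `[1, p)`)] -/
theorem mem_suppFinset {D : CpDivisor p} {μ : ℝ} :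
    μ ∈ suppFinset D ↔ 1 < μ ∧ μ < p ∧ D.toFun μ ≠ 0 := by
  unfold suppFinset
  rw [Finset.mem_filter, Set.Finite.mem_toFinset]
  constructor
  · rintro ⟨⟨_, h2, h3⟩, h4⟩; exact ⟨h4, h2, h3⟩
  · rintro ⟨h1, h2, h3⟩; exact ⟨⟨h1.le, h2, h3⟩, h1⟩

omit hp in
/-- Support points lie in `(1, p)`. [cite: ConnesConsani2017ScalingSite, §5.2] -/
theorem suppFinset_bound {D : CpDivisor p} : ∀ t ∈ suppFinset D, 1 < t ∧ t < (p : ℝ) :=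
  fun _ ht => ⟨(mem_suppFinset.1 ht).1, (mem_suppFinset.1 ht).2.1⟩

omit hp in
/-- `D` vanishes on `(1, p)` off `suppFinset D`. [cite: ConnesConsani2017ScalingSite, Def. 5.3] -/
theorem CpDivisor.apply_eq_zero_of_not_mem {D : CpDivisor p} {x : ℝ} (h1 : 1 < x) (h2 : x < p)
    (hx : x ∉ suppFinset D) : D.toFun x = 0 := by
  by_contra h
  exact hx (mem_suppFinset.2 ⟨h1, h2, h⟩)

/-- The integral slope drop `k_μ = ⌈p^m D(μ)/μ⌉` put at the support point `μ` (the translation of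
Lemma 5.18 (i) making all elements convex). [cite: ConnesConsani2017ScalingSite, Lemma 5.18 (i)] -/
def kinkWeight (D : CpDivisor p) (m : ℕ) (μ : ℝ) : ℕ := ⌈(p : ℝ) ^ m * D.toFun μ / μ⌉₊

/-- The total slope drop `K = Σ_μ k_μ`. [cite: ConnesConsani2017ScalingSite, Lemma 5.18 (i)] -/
def totalKink (D : CpDivisor p) (m : ℕ) : ℕ := ∑ μ ∈ suppFinset D, kinkWeight D m μ

/-- `n_μ := ⌈k_μ - p^m D(μ)/μ⌉`: the number of generators `(x - μ)₊` that `D + (f) ≥ 0` forces to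
sit at the support point `μ` after the translation by `Σ k_μ (x - μ)₊`.
[cite: ConnesConsani2017ScalingSite, Lemma 5.18 (i)] -/
def pinCount (D : CpDivisor p) (m : ℕ) (μ : ℝ) : ℕ :=
  ⌈(kinkWeight D m μ : ℝ) - (p : ℝ) ^ m * D.toFun μ / μ⌉₊

/-- `N = Σ_μ n_μ`. [cite: ConnesConsani2017ScalingSite, Lemma 5.18 (i)] -/
def totalPin (D : CpDivisor p) (m : ℕ) : ℕ := ∑ μ ∈ suppFinset D, pinCount D m μ

/-- `B₁ := ⌈p^m |D(1)|⌉`. [cite: ConnesConsani2017ScalingSite, Lemma 5.19 (i) (`N` there)] -/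
def oneBound (D : CpDivisor p) (m : ℕ) : ℕ := ⌈(p : ℝ) ^ m * |D.toFun 1|⌉₊

/-- `W := p^m D(1) + Σ_μ (k_μ - n_μ) μ`: the bound on the number of free generators at level
`p^m` (it differs from `p^m deg D` by at most `Σ_μ μ`). [cite: ConnesConsani2017ScalingSite, Lemma 5.19 (iv)] -/
def freeBound (D : CpDivisor p) (m : ℕ) : ℝ :=
  (p : ℝ) ^ m * D.toFun 1 + ∑ μ ∈ suppFinset D, ((kinkWeight D m μ : ℝ) - pinCount D m μ) * μ

/-- The slope normalisation `A` at `1` used at level `p^m` (any `A ≥ pK + B₁` represents every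
element; the extra room serves the lower bound). [cite: ConnesConsani2017ScalingSite, Lemma 5.19 (i)] -/
def bigA (D : CpDivisor p) (m : ℕ) : ℕ :=
  p * totalKink D m + oneBound D m + ⌊freeBound D m⌋₊ + 2 * totalPin D m + 2

/-- The number `M` of generators `(x - y_σ)₊` used at level `p^m`. [cite: ConnesConsani2017ScalingSite, Lemma 5.19 (iii)] -/
def bigM (D : CpDivisor p) (m : ℕ) : ℕ :=
  bigA D m + 2 * totalKink D m + totalPin D m + oneBound D m + 2 * p

/-- Partial kink sums `κ(u) = Σ_{μ ∈ supp D, μ ≤ u} k_μ`. [cite: ConnesConsani2017ScalingSite, Lemma 5.18 (i)] -/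
def kinkUpTo (D : CpDivisor p) (m : ℕ) (u : ℝ) : ℕ :=
  ∑ μ ∈ (suppFinset D).filter (fun μ => μ ≤ u), kinkWeight D m μ

omit hp in
/-- `κ(u) ≤ K`. [cite: ConnesConsani2017ScalingSite, Lemma 5.18 (i)] -/
theorem kinkUpTo_le (D : CpDivisor p) (m : ℕ) (u : ℝ) : kinkUpTo D m u ≤ totalKink D m :=
  Finset.sum_le_sum_of_subset (Finset.filter_subset _ _)

omit hp in
/-- `κ(1) = 0`. [cite: ConnesConsani2017ScalingSite, Lemma 5.18 (i)] -/
theorem kinkUpTo_one (D : CpDivisor p) (m : ℕ) : kinkUpTo D m 1 = 0 := by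
  unfold kinkUpTo
  rw [Finset.filter_false_of_mem, Finset.sum_empty]
  exact fun μ hμ => not_le.2 (mem_suppFinset.1 hμ).1

omit hp in
/-- The kinks sitting exactly at `b`. [cite: ConnesConsani2017ScalingSite, Lemma 5.18 (i)] -/
theorem sum_kink_filter_eq (D : CpDivisor p) (m : ℕ) (b : ℝ) :
    ∑ μ ∈ (suppFinset D).filter (fun μ => μ = b), kinkWeight D m μ =
      if b ∈ suppFinset D then kinkWeight D m b else 0 := by
  rw [Finset.filter_eq']
  split_ifs <;> simp

/-- `κ(t_{j+1}) = κ(t_j) + [t_{j+1} ∈ supp] k_{t_{j+1}}` along break points containing the support.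
[cite: ConnesConsani2017ScalingSite, Lemma 5.18 (i)] -/
theorem kinkUpTo_bpts_succ {D : CpDivisor p} {m : ℕ} {T : Finset ℝ}
    (hT : ∀ t ∈ T, 1 < t ∧ t < p) (hsub : suppFinset D ⊆ T) {j : ℕ} (hj : j + 1 ≤ T.card) :
    kinkUpTo D m (bpts p T (j + 1)) = kinkUpTo D m (bpts p T j) +
      (if bpts p T (j + 1) ∈ suppFinset D then kinkWeight D m (bpts p T (j + 1)) else 0) := by
  classical
  have hp1 := hp.out.one_lt
  rw [← sum_kink_filter_eq]
  unfold kinkUpTo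
  have hab : bpts p T j < bpts p T (j + 1) := bpts_lt_succ hp1 hT (by omega)
  have hμ : ∀ μ ∈ suppFinset D,
      (μ ≤ bpts p T (j + 1) ↔ μ ≤ bpts p T j ∨ μ = bpts p T (j + 1)) := by
    intro μ hμm
    constructor
    · intro h
      by_contra h'
      push Not at h'
      exact not_mem_Ioo_bpts hp1 hT (Or.inl (hsub hμm)) (i := j) (by omega)
        ⟨h'.1, lt_of_le_of_ne h h'.2⟩
    · rintro (h | h)
      · exact h.trans hab.le
      · exact h.le
  rw [← Finset.sum_union]
  · refine Finset.sum_congr ?_ (fun _ _ => rfl)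
    rw [← Finset.filter_or]
    ext μ
    simp only [Finset.mem_filter]
    constructor
    · rintro ⟨h1, h2⟩; exact ⟨h1, (hμ μ h1).1 h2⟩
    · rintro ⟨h1, h2⟩; exact ⟨h1, (hμ μ h1).2 h2⟩
  · rw [Finset.disjoint_filter]
    intro μ _ h1 h2
    rw [h2] at h1
    exact absurd h1 (not_le.2 hab)

/-- `|p^m D(1)| ≤ B₁`. [cite: ConnesConsani2017ScalingSite, Lemma 5.19 (i)] -/
theorem abs_le_oneBound (D : CpDivisor p) (m : ℕ) :
    |(p : ℝ) ^ m * D.toFun 1| ≤ oneBound D m := by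
  unfold oneBound
  rw [abs_mul, abs_of_pos (pow_pos (by exact_mod_cast hp.out.pos) m)]
  exact Nat.le_ceil _

omit hp in
/-- `#{σ : Fin M | σ < N} = N` for `N ≤ M`. [folklore] -/
private theorem card_filter_val_lt {M N : ℕ} (hN : N ≤ M) :
    (Finset.univ.filter fun σ : Fin M => (σ : ℕ) < N).card = N := by
  rw [show (Finset.univ.filter fun σ : Fin M => (σ : ℕ) < N) =
      (Finset.univ : Finset (Fin N)).map (Fin.castLEEmb hN) from ?_]
  · simp
  · ext σ
    simp only [Finset.mem_filter, Finset.mem_univ, true_and, Finset.mem_map]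
    constructor
    · intro h
      exact ⟨⟨σ, h⟩, Fin.ext rfl⟩
    · rintro ⟨τ, rfl⟩
      exact τ.2

/-- The parametrised piecewise affine function on `[1, p]`:
`F_{t,y}(x) = t - A (x - 1) + Σ_σ (x - y_σ)₊ - Σ_μ k_μ (x - μ)₊` — the convex normal form of
Lemma 5.19 (i) (sorted break points `y_σ` with multiplicity) plus the fixed concave part.
[cite: ConnesConsani2017ScalingSite, Lemma 5.19 (i)–(iii)] -/
def paramFun (D : CpDivisor p) (m A : ℕ) {M : ℕ} (t : ℝ) (y : Fin M → ℝ) (x : ℝ) : ℝ :=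
  t - A * (x - 1) + (∑ σ, hinge (y σ) x) -
    ∑ μ ∈ suppFinset D, (kinkWeight D m μ : ℝ) * hinge μ x

/-- The corresponding element of `𝒦(C_p)`: `x ↦ p^{-m} F_{t,y}(x̄)`, `x̄ ∈ [1, p)` the representative
(inverse Frobenius of Lemma 5.18 (ii)). [cite: ConnesConsani2017ScalingSite, Lemma 5.18 (ii)] -/
def paramElem (D : CpDivisor p) (m A : ℕ) {M : ℕ} (t : ℝ) (y : Fin M → ℝ) (x : ℝ) : ℝ :=
  ((p : ℝ) ^ m)⁻¹ * paramFun D m A t y (fundRed p 1 x)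

/-- The integer slope of `F_{t,y}` to the right of `u`:
`-A + #{σ | y_σ ≤ u} - Σ_{μ ≤ u} k_μ`. [cite: ConnesConsani2017ScalingSite, Lemma 5.19 (iii)] -/
def slopeAt (D : CpDivisor p) (m A : ℕ) {M : ℕ} (y : Fin M → ℝ) (u : ℝ) : ℤ :=
  -(A : ℤ) + ((Finset.univ.filter fun σ => y σ ≤ u).card : ℤ) -
    ∑ μ ∈ (suppFinset D).filter (fun μ => μ ≤ u), (kinkWeight D m μ : ℤ)

omit hp in
/-- **Affine pieces of `F_{t,y}`**: if no break point lies strictly between `u ≤ v`, then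
`F_{t,y}(x) = F_{t,y}(u) + s (x - u)` on `[u, v]` with the integer slope `s = slopeAt y u`.
[cite: ConnesConsani2017ScalingSite, Lemma 5.19 (iii)] -/
theorem paramFun_affine (D : CpDivisor p) (m A : ℕ) {M : ℕ} (t : ℝ) (y : Fin M → ℝ) {u v : ℝ}
    (hy : ∀ σ, y σ ≤ u ∨ v ≤ y σ) (hμ : ∀ μ ∈ suppFinset D, μ ≤ u ∨ v ≤ μ) {x : ℝ}
    (hx1 : u ≤ x) (hx2 : x ≤ v) :
    paramFun D m A t y x = paramFun D m A t y u + (slopeAt D m A y u : ℝ) * (x - u) := by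
  classical
  unfold paramFun slopeAt
  have hσ : ∀ σ, hinge (y σ) x - hinge (y σ) u = if y σ ≤ u then x - u else 0 := by
    intro σ
    rcases hy σ with h | h
    · rw [if_pos h, hinge_of_le h, hinge_of_le (h.trans hx1)]; ring
    · by_cases h' : y σ ≤ u
      · have : y σ = u := le_antisymm h' (hx1.trans (hx2.trans h))
        rw [if_pos h', hinge_of_le h', hinge_of_le (h'.trans hx1)]; ring
      · rw [if_neg h', hinge_of_ge (hx2.trans h), hinge_of_ge ((hx1.trans hx2).trans h)]; ring
  have hμ' : ∀ μ ∈ suppFinset D, (kinkWeight D m μ : ℝ) * hinge μ x -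
      (kinkWeight D m μ : ℝ) * hinge μ u =
      if μ ≤ u then (kinkWeight D m μ : ℝ) * (x - u) else 0 := by
    intro μ hμm
    rcases hμ μ hμm with h | h
    · rw [if_pos h, hinge_of_le h, hinge_of_le (h.trans hx1)]; ring
    · by_cases h' : μ ≤ u
      · rw [if_pos h', hinge_of_le h', hinge_of_le (h'.trans hx1)]; ring
      · rw [if_neg h', hinge_of_ge (hx2.trans h), hinge_of_ge ((hx1.trans hx2).trans h)]; ring
  have e1 : (∑ σ, hinge (y σ) x) = (∑ σ, hinge (y σ) u) +
      ((Finset.univ.filter fun σ => y σ ≤ u).card : ℝ) * (x - u) := by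
    have : (∑ σ, hinge (y σ) x) - (∑ σ, hinge (y σ) u) =
        ((Finset.univ.filter fun σ => y σ ≤ u).card : ℝ) * (x - u) := by
      rw [← Finset.sum_sub_distrib, Finset.sum_congr rfl fun σ _ => hσ σ, Finset.sum_ite,
        Finset.sum_const_zero, add_zero, Finset.sum_const, nsmul_eq_mul]
    linarith
  have e2 : (∑ μ ∈ suppFinset D, (kinkWeight D m μ : ℝ) * hinge μ x) =
      (∑ μ ∈ suppFinset D, (kinkWeight D m μ : ℝ) * hinge μ u) +
      (∑ μ ∈ (suppFinset D).filter (fun μ => μ ≤ u), (kinkWeight D m μ : ℝ)) * (x - u) := by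
    have : (∑ μ ∈ suppFinset D, (kinkWeight D m μ : ℝ) * hinge μ x) -
        (∑ μ ∈ suppFinset D, (kinkWeight D m μ : ℝ) * hinge μ u) =
        (∑ μ ∈ (suppFinset D).filter (fun μ => μ ≤ u), (kinkWeight D m μ : ℝ)) * (x - u) := by
      rw [← Finset.sum_sub_distrib, Finset.sum_congr rfl fun μ hμm => hμ' μ hμm, Finset.sum_ite,
        Finset.sum_const_zero, add_zero, Finset.sum_mul]
    linarith
  rw [e1, e2]
  push_cast
  ring

omit hp in
/-- Right slope of `F_{t,y}` at any `u`: `slopeAt y u`. [cite: ConnesConsani2017ScalingSite, Lemma 5.19 (iii)] -/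
theorem hasDerivWithinAt_paramFun_Ioi (D : CpDivisor p) (m A : ℕ) {M : ℕ} (t : ℝ) (y : Fin M → ℝ)
    (u : ℝ) : HasDerivWithinAt (paramFun D m A t y) (slopeAt D m A y u : ℝ) (Ioi u) u := by
  classical
  -- choose `v > u` below all break points `> u`
  obtain ⟨v, huv, hy, hμ⟩ : ∃ v, u < v ∧ (∀ σ, y σ ≤ u ∨ v ≤ y σ) ∧
      ∀ μ ∈ suppFinset D, μ ≤ u ∨ v ≤ μ := by
    set B : Finset ℝ := (Finset.univ.image y ∪ suppFinset D).filter (fun b => u < b) with hB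
    rcases B.eq_empty_or_nonempty with hBe | hBne
    · refine ⟨u + 1, by linarith, fun σ => ?_, fun μ hμm => ?_⟩
      · left; by_contra h; push Not at h
        have : y σ ∈ B := by
          rw [hB, Finset.mem_filter]; exact ⟨Finset.mem_union_left _ (Finset.mem_image_of_mem _ (Finset.mem_univ _)), h⟩
        rw [hBe] at this; exact absurd this (Finset.notMem_empty _)
      · left; by_contra h; push Not at h
        have : μ ∈ B := by rw [hB, Finset.mem_filter]; exact ⟨Finset.mem_union_right _ hμm, h⟩
        rw [hBe] at this; exact absurd this (Finset.notMem_empty _)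
    · have hmemB : ∀ b, b ∈ B → u < b := by
        intro b hb
        rw [hB, Finset.mem_filter] at hb
        exact hb.2
      refine ⟨B.min' hBne, hmemB _ (Finset.min'_mem B hBne), fun σ => ?_, fun μ hμm => ?_⟩
      · by_cases h : y σ ≤ u
        · exact Or.inl h
        · right; push Not at h
          exact Finset.min'_le B _ (by rw [hB, Finset.mem_filter]; exact
            ⟨Finset.mem_union_left _ (Finset.mem_image_of_mem _ (Finset.mem_univ _)), h⟩)
      · by_cases h : μ ≤ u
        · exact Or.inl h
        · right; push Not at h
          exact Finset.min'_le B _ (by rw [hB, Finset.mem_filter]; exact ⟨Finset.mem_union_right _ hμm, h⟩)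
  exact hasDerivWithinAt_Ioi_of_affine (δ := v - u) (c := paramFun D m A t y u) (by linarith)
    fun x hx1 hx2 => by rw [paramFun_affine D m A t y hy hμ hx1 (by linarith)]

omit hp in
/-- `F_{t,y}` is continuous. [cite: ConnesConsani2017ScalingSite, Lemma 5.19 (iii)] -/
theorem continuous_paramFun (D : CpDivisor p) (m A : ℕ) {M : ℕ} (t : ℝ) (y : Fin M → ℝ) :
    Continuous (paramFun D m A t y) := by
  unfold paramFun
  refine ((continuous_const.sub (continuous_const.mul (continuous_id.sub continuous_const))).add
    (continuous_finsetSum _ fun σ _ => continuous_hinge _)).sub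
    (continuous_finsetSum _ fun μ _ => continuous_const.mul (continuous_hinge μ))

omit hp in
/-- `F_{t,y}(1) = t` when all `y_σ ≥ 1`. [cite: ConnesConsani2017ScalingSite, Lemma 5.19 (iii) ("the value … at `λ = 1` is `-t₀`")] -/
theorem paramFun_one (D : CpDivisor p) (m A : ℕ) {M : ℕ} (t : ℝ) {y : Fin M → ℝ}
    (hy : ∀ σ, 1 ≤ y σ) : paramFun D m A t y 1 = t := by
  unfold paramFun
  rw [Finset.sum_eq_zero fun σ _ => hinge_of_ge (hy σ), Finset.sum_eq_zero fun μ hμ => by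
    rw [hinge_of_ge (mem_suppFinset.1 hμ).1.le, mul_zero]]
  ring


/-! ### Validity of parameters and membership in `H⁰(D)^{p^m}` -/

/-- The break points of `F_{t,y}` inside `(1, p)`: the `y_σ` and the support points.
[cite: ConnesConsani2017ScalingSite, Lemma 5.19 (iii)] -/
def paramBpts (D : CpDivisor p) {M : ℕ} (y : Fin M → ℝ) : Finset ℝ :=
  (Finset.univ.image y ∪ suppFinset D).filter (fun b => 1 < b ∧ b < p)

omit hp in
/-- The break points lie in `(1, p)`. [cite: ConnesConsani2017ScalingSite, Lemma 5.19 (iii)] -/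
theorem paramBpts_bound (D : CpDivisor p) {M : ℕ} (y : Fin M → ℝ) :
    ∀ t ∈ paramBpts D y, 1 < t ∧ t < (p : ℝ) := fun _ ht => (Finset.mem_filter.1 ht).2

omit hp in
/-- The support points are break points. [cite: ConnesConsani2017ScalingSite, Lemma 5.19 (iii)] -/
theorem supp_subset_paramBpts (D : CpDivisor p) {M : ℕ} (y : Fin M → ℝ) :
    suppFinset D ⊆ paramBpts D y := fun μ hμ =>
  Finset.mem_filter.2 ⟨Finset.mem_union_right _ hμ, suppFinset_bound μ hμ⟩

/-- **Admissible parameters** (the closed conditions cut out of the parameter space by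
`D + (f) ≥ 0` and `f(p) = f(1)`; Lemma 5.19 (i) for `D = N{1}`: "convex, piecewise affine … with
integral slopes, such that `f(1) = f(p)` and `-f'₊(1) + p f'₋(p) ≤ N`").
[cite: ConnesConsani2017ScalingSite, Lemma 5.19 (i)] -/
structure ParamValid (D : CpDivisor p) (m A : ℕ) {M : ℕ} (t : ℝ) (y : Fin M → ℝ) : Prop where
  one_le : ∀ σ, 1 ≤ y σ
  le_p : ∀ σ, y σ ≤ p
  pinned : ∀ μ ∈ suppFinset D, (kinkWeight D m μ : ℝ) - (p : ℝ) ^ m * D.toFun μ / μ ≤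
    ((Finset.univ.filter fun σ => y σ = μ).card : ℝ)
  clos : paramFun D m A t y p = paramFun D m A t y 1
  ordOne : -((p : ℝ) ^ m * D.toFun 1) ≤
    (-(A : ℝ) + (Finset.univ.filter fun σ => y σ = 1).card) -
      p * (-(A : ℝ) + (Finset.univ.filter fun σ => y σ < p).card - totalKink D m)

section Membership

variable {D : CpDivisor p} {m A M : ℕ} {t : ℝ} {y : Fin M → ℝ}

omit hp in
/-- Each `y_σ` is an inner break point, `1`, or `p`. [cite: ConnesConsani2017ScalingSite, Lemma 5.19 (iii)] -/
theorem ParamValid.y_cases (hv : ParamValid D m A t y) (σ : Fin M) :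
    y σ ∈ paramBpts D y ∨ y σ = 1 ∨ y σ = p := by
  rcases (hv.one_le σ).eq_or_lt with h | h
  · exact Or.inr (Or.inl h.symm)
  rcases (hv.le_p σ).lt_or_eq with h' | h'
  · exact Or.inl (Finset.mem_filter.2
      ⟨Finset.mem_union_left _ (Finset.mem_image_of_mem _ (Finset.mem_univ _)), h, h'⟩)
  · exact Or.inr (Or.inr h')

/-- No `y_σ` lies strictly inside a piece. [cite: ConnesConsani2017ScalingSite, Lemma 5.19 (iii)] -/
theorem ParamValid.y_le_or_ge (hv : ParamValid D m A t y) {j : ℕ} (hj : j ≤ (paramBpts D y).card)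
    (σ : Fin M) : y σ ≤ bpts p (paramBpts D y) j ∨ bpts p (paramBpts D y) (j + 1) ≤ y σ := by
  have := not_mem_Ioo_bpts hp.out.one_lt (paramBpts_bound D y) (hv.y_cases σ) hj
  by_contra h
  push Not at h
  exact this ⟨h.1, h.2⟩

/-- No support point lies strictly inside a piece. [cite: ConnesConsani2017ScalingSite, Lemma 5.19 (iii)] -/
theorem supp_le_or_ge (y : Fin M → ℝ) {j : ℕ} (hj : j ≤ (paramBpts D y).card)
    {μ : ℝ} (hμ : μ ∈ suppFinset D) :
    μ ≤ bpts p (paramBpts D y) j ∨ bpts p (paramBpts D y) (j + 1) ≤ μ := by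
  have := not_mem_Ioo_bpts hp.out.one_lt (paramBpts_bound D y)
    (Or.inl (supp_subset_paramBpts D y hμ)) hj
  by_contra h
  push Not at h
  exact this ⟨h.1, h.2⟩

/-- Periodicity of the parametrised element. [cite: ConnesConsani2017ScalingSite, Lemma 5.18 (ii)] -/
theorem paramElem_mul_p {x : ℝ} (hx : 0 < x) :
    paramElem D m A t y (p * x) = paramElem D m A t y x := by
  unfold paramElem
  rw [fundRed_mul_p hp.out.one_lt one_pos hx]

/-- **Piece data of the parametrised element** (via `CpPieces.ofFinset`): break points
`paramBpts`, slopes `slopeAt / p^m`. [cite: ConnesConsani2017ScalingSite, Lemma 5.19 (iii)] -/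
theorem ParamValid.exists_cpPieces (hv : ParamValid D m A t y) :
    ∃ P : CpPieces p (paramElem D m A t y), P.lam = bpts p (paramBpts D y) ∧
      P.n = (paramBpts D y).card ∧
      ∀ j, j ≤ (paramBpts D y).card →
        P.h j = (slopeAt D m A y (bpts p (paramBpts D y) j) : ℝ) / (p : ℝ) ^ m := by
  have hp1 := hp.out.one_lt
  have hpm : (0 : ℝ) < (p : ℝ) ^ m := pow_pos (by exact_mod_cast hp.out.pos) m
  set T := paramBpts D y with hT
  refine ⟨CpPieces.ofFinset hp1 T (paramBpts_bound D y)
    (F := fun x => ((p : ℝ) ^ m)⁻¹ * paramFun D m A t y x) (g := paramElem D m A t y)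
    (fun x _ => rfl)
    (show ((p : ℝ) ^ m)⁻¹ * paramFun D m A t y p = ((p : ℝ) ^ m)⁻¹ * paramFun D m A t y 1 by
      rw [hv.clos])
    (fun j => (slopeAt D m A y (bpts p T j) : ℝ) / (p : ℝ) ^ m)
    (fun j _ => ⟨_, m, rfl⟩) ?_, rfl, rfl, fun j _ => rfl⟩
  intro j hj x hx1 hx2
  show ((p : ℝ) ^ m)⁻¹ * paramFun D m A t y x =
    ((p : ℝ) ^ m)⁻¹ * paramFun D m A t y (bpts p T j) +
      (slopeAt D m A y (bpts p T j) : ℝ) / (p : ℝ) ^ m * (x - bpts p T j)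
  rw [paramFun_affine D m A t y (hv.y_le_or_ge hj) (fun μ hμ => supp_le_or_ge y hj hμ) hx1 hx2]
  field_simp
  ring

/-- The parametrised element belongs to `𝒦(C_p)`. [cite: ConnesConsani2017ScalingSite, Lemma 5.19 (i)] -/
theorem ParamValid.isCpRational (hv : ParamValid D m A t y) :
    IsCpRational p (paramElem D m A t y) := by
  obtain ⟨P, -, -, -⟩ := hv.exists_cpPieces
  exact P.isCpRational fun x hx => paramElem_mul_p hx

/-- The parametrised element has `‖·‖_p ≤ p^m` (integral slopes after Frobenius, Prop. 5.15 (iv)).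
[cite: ConnesConsani2017ScalingSite, Prop. 5.15 (iv), Lemma 5.18 (ii)] -/
theorem ParamValid.cpSlopeNorm_le (hv : ParamValid D m A t y) :
    cpSlopeNorm p (paramElem D m A t y) ≤ (p : ℝ) ^ m := by
  obtain ⟨P, hPl, hPn, hPh⟩ := hv.exists_cpPieces
  exact P.cpSlopeNorm_le_of_h_eq hv.isCpRational hPl hPn
    (fun j => slopeAt D m A y (bpts p (paramBpts D y) j)) hPh

omit hp in
/-- The slope right of `1`: `-A + #{σ | y_σ = 1}`. [cite: ConnesConsani2017ScalingSite, Lemma 5.19 (i) (`α = -f'₊(1)`)] -/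
theorem slopeAt_one (hv1 : ∀ σ, 1 ≤ y σ) :
    slopeAt D m A y 1 = -(A : ℤ) + ((Finset.univ.filter fun σ => y σ = 1).card : ℤ) := by
  unfold slopeAt
  have h1 : (Finset.univ.filter fun σ => y σ ≤ 1) = Finset.univ.filter fun σ => y σ = 1 := by
    ext σ; simp only [Finset.mem_filter, Finset.mem_univ, true_and]
    exact ⟨fun h => le_antisymm h (hv1 σ), fun h => h.le⟩
  have h2 : (suppFinset D).filter (fun μ => μ ≤ 1) = ∅ := by
    ext μ
    simp only [Finset.mem_filter, Finset.notMem_empty, iff_false, not_and, not_le]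
    exact fun hμ => (mem_suppFinset.1 hμ).1
  rw [h1, h2, Finset.sum_empty, sub_zero]

/-- The slope left of `p`: `-A + #{σ | y_σ < p} - K`. [cite: ConnesConsani2017ScalingSite, Lemma 5.19 (i) (`β = f'₋(p)`)] -/
theorem ParamValid.slopeAt_last (hv : ParamValid D m A t y) :
    slopeAt D m A y (bpts p (paramBpts D y) (paramBpts D y).card) =
      -(A : ℤ) + ((Finset.univ.filter fun σ => y σ < p).card : ℤ) - (totalKink D m : ℤ) := by
  have hp1 := hp.out.one_lt
  set T := paramBpts D y with hT
  have hTb : ∀ t ∈ T, 1 < t ∧ t < (p : ℝ) := paramBpts_bound D y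
  have hbn : bpts p T T.card < p := bpts_lt_p hp1 hTb le_rfl
  have key : ∀ b, (b ∈ T ∨ b = 1 ∨ b = (p : ℝ)) → (b ≤ bpts p T T.card ↔ b < p) := by
    intro b hb
    constructor
    · exact fun h => h.trans_lt hbn
    · intro hlt
      rcases hb with hb | rfl | rfl
      · obtain ⟨i, -, hi2, hi3⟩ := exists_bpts_eq (p := p) hb
        rw [← hi3]; exact bpts_le_of_le hp1 hTb hi2 (by omega)
      · rw [← bpts_zero (p := p) (T := T)]; exact bpts_le_of_le hp1 hTb (Nat.zero_le _) (by omega)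
      · exact absurd hlt (lt_irrefl _)
  unfold slopeAt totalKink
  have h1 : (Finset.univ.filter fun σ => y σ ≤ bpts p T T.card) =
      Finset.univ.filter fun σ => y σ < p := by
    ext σ; simp only [Finset.mem_filter, Finset.mem_univ, true_and]
    exact key _ (hv.y_cases σ)
  have h2 : (suppFinset D).filter (fun μ => μ ≤ bpts p T T.card) = suppFinset D := by
    ext μ
    simp only [Finset.mem_filter, and_iff_left_iff_imp]
    intro hμ
    exact (key μ (Or.inl (supp_subset_paramBpts D y hμ))).2 (mem_suppFinset.1 hμ).2.1
  rw [h1, h2]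
  push_cast
  ring

/-- The slope jump at a middle break point `b = t_{j+1}`: `#{σ | y_σ = b} - k_b`.
[cite: ConnesConsani2017ScalingSite, Lemma 5.19 (iii) ("`h` passes from the slope … to the slope … at the point")] -/
theorem ParamValid.slopeAt_succ_sub (hv : ParamValid D m A t y) {j : ℕ}
    (hj : j + 1 ≤ (paramBpts D y).card) :
    slopeAt D m A y (bpts p (paramBpts D y) (j + 1)) - slopeAt D m A y (bpts p (paramBpts D y) j) =
      ((Finset.univ.filter fun σ => y σ = bpts p (paramBpts D y) (j + 1)).card : ℤ) -
        ∑ μ ∈ (suppFinset D).filter (fun μ => μ = bpts p (paramBpts D y) (j + 1)),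
          (kinkWeight D m μ : ℤ) := by
  classical
  have hp1 := hp.out.one_lt
  have hTb := paramBpts_bound D y
  set b := bpts p (paramBpts D y) (j + 1) with hb
  set a := bpts p (paramBpts D y) j with ha
  have hab : a < b := bpts_lt_succ hp1 hTb (by omega)
  unfold slopeAt
  have hy : ∀ σ, y σ ≤ b ↔ y σ ≤ a ∨ y σ = b := by
    intro σ
    constructor
    · intro h
      rcases hv.y_le_or_ge (j := j) (by omega) σ with h' | h'
      · exact Or.inl h'
      · exact Or.inr (le_antisymm h h')
    · rintro (h | h)
      · exact h.trans hab.le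
      · exact h.le
  have hμ : ∀ μ ∈ suppFinset D, (μ ≤ b ↔ μ ≤ a ∨ μ = b) := by
    intro μ hμm
    constructor
    · intro h
      rcases supp_le_or_ge y (j := j) (by omega) hμm with h' | h'
      · exact Or.inl h'
      · exact Or.inr (le_antisymm h h')
    · rintro (h | h)
      · exact h.trans hab.le
      · exact h.le
  have e1 : (Finset.univ.filter fun σ => y σ ≤ b) =
      (Finset.univ.filter fun σ => y σ ≤ a) ∪ Finset.univ.filter fun σ => y σ = b := by
    rw [← Finset.filter_or]; ext σ; simp only [Finset.mem_filter, Finset.mem_univ, true_and]; exact hy σ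
  have d1 : Disjoint (Finset.univ.filter fun σ => y σ ≤ a) (Finset.univ.filter fun σ => y σ = b) := by
    rw [Finset.disjoint_filter]; intro σ _ h1 h2; rw [h2] at h1; exact absurd h1 (not_le.2 hab)
  have e2 : (suppFinset D).filter (fun μ => μ ≤ b) =
      (suppFinset D).filter (fun μ => μ ≤ a) ∪ (suppFinset D).filter (fun μ => μ = b) := by
    rw [← Finset.filter_or]; ext μ; simp only [Finset.mem_filter]
    constructor
    · rintro ⟨h1, h2⟩; exact ⟨h1, (hμ μ h1).1 h2⟩
    · rintro ⟨h1, h2⟩; exact ⟨h1, (hμ μ h1).2 h2⟩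
  have d2 : Disjoint ((suppFinset D).filter (fun μ => μ ≤ a))
      ((suppFinset D).filter (fun μ => μ = b)) := by
    rw [Finset.disjoint_filter]; intro μ _ h1 h2; rw [h2] at h1; exact absurd h1 (not_le.2 hab)
  rw [e1, e2, Finset.card_union_of_disjoint d1, Finset.sum_union d2]
  push_cast
  ring

/-- **The parametrised element solves the Riemann–Roch inequality `D + (f) ≥ 0`.**
[cite: ConnesConsani2017ScalingSite, §5.4 eq. (43) and Lemma 5.19 (i)] -/
theorem ParamValid.divisor_nonneg (hv : ParamValid D m A t y) {x : ℝ} (hx : 0 < x) :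
    0 ≤ D.toFun x + cpOrder (paramElem D m A t y) x := by
  classical
  have hp1 := hp.out.one_lt
  have hp0 := hp.out.pos
  have hpR : (0 : ℝ) < p := by exact_mod_cast hp0
  have hpm : (0 : ℝ) < (p : ℝ) ^ m := pow_pos hpR m
  obtain ⟨P, hPl, hPn, hPh⟩ := hv.exists_cpPieces
  set T := paramBpts D y with hT
  have hTb : ∀ t ∈ T, 1 < t ∧ t < (p : ℝ) := paramBpts_bound D y
  have hper : ∀ u, 0 < u → paramElem D m A t y (p * u) = paramElem D m A t y u :=
    fun u hu => paramElem_mul_p hu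
  obtain ⟨k, x₀, hx₀1, hx₀2, rfl, hord⟩ := P.exists_cpOrder_eq hp1 hper hx
  rw [hord, CpDivisor.apply_zpow_mul hp0 D (P.lam_pos.trans_le hx₀1)]
  rw [hPl, bpts_zero] at hx₀1
  rw [hPl, hPn, bpts_of_card_lt (Nat.lt_succ_self _)] at hx₀2
  obtain ⟨j, hj, hj1, hj2⟩ := exists_bpts_piece_right (T := T) hx₀1 hx₀2
  rcases hj1.eq_or_lt with heq | hlt
  · -- `x₀` is a break point
    rcases Nat.eq_zero_or_pos j with rfl | hjpos
    · -- `x₀ = 1`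
      rw [bpts_zero] at heq
      rw [← heq]
      have h1 : cpOrder (paramElem D m A t y) 1 = P.lam 0 * (P.h 0 - p * P.h P.n) :=
        by rw [← P.cpOrder_lam_zero hp0 hper, hPl, bpts_zero]
      rw [h1, hPl, bpts_zero, one_mul, hPn, hPh 0 (Nat.zero_le _), hPh _ le_rfl, bpts_zero,
        slopeAt_one hv.one_le, hv.slopeAt_last]
      have := hv.ordOne
      rw [← sub_nonneg] at this
      have e : D.toFun 1 + (((-(A : ℤ) + ((Finset.univ.filter fun σ => y σ = 1).card : ℤ) : ℤ) : ℝ) /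
          (p : ℝ) ^ m - p * ((((-(A : ℤ) + ((Finset.univ.filter fun σ => y σ < p).card : ℤ) -
            (totalKink D m : ℤ)) : ℤ) : ℝ) / (p : ℝ) ^ m)) =
          ((p : ℝ) ^ m * D.toFun 1 + ((-(A : ℝ) + (Finset.univ.filter fun σ => y σ = 1).card) -
            p * (-(A : ℝ) + (Finset.univ.filter fun σ => y σ < p).card - totalKink D m))) /
          (p : ℝ) ^ m := by
        push_cast
        field_simp
      rw [e]
      exact div_nonneg (by linarith) hpm.le
    · -- `x₀ = t_j`, `1 ≤ j ≤ N`
      obtain ⟨i, rfl⟩ : ∃ i, j = i + 1 := ⟨j - 1, by omega⟩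
      have h1 : cpOrder (paramElem D m A t y) (bpts p T (i + 1)) =
          bpts p T (i + 1) * (P.h (i + 1) - P.h i) := by
        have := P.cpOrder_lam_succ (j := i) (by omega)
        rwa [hPl] at this
      rw [← heq, h1, hPh _ hj, hPh _ (by omega)]
      have hsub := hv.slopeAt_succ_sub (j := i) hj
      set b := bpts p T (i + 1) with hb
      have hb0 : 0 < b := by rw [heq]; linarith
      have e : D.toFun b + b * (((slopeAt D m A y b : ℤ) : ℝ) / (p : ℝ) ^ m -
          ((slopeAt D m A y (bpts p T i) : ℤ) : ℝ) / (p : ℝ) ^ m) =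
          (b / (p : ℝ) ^ m) * ((p : ℝ) ^ m * D.toFun b / b +
            (((slopeAt D m A y b - slopeAt D m A y (bpts p T i) : ℤ) : ℝ))) := by
        push_cast
        field_simp
      rw [e]
      refine mul_nonneg (div_nonneg hb0.le hpm.le) ?_
      rw [hsub, Finset.filter_eq']
      by_cases hbs : b ∈ suppFinset D
      · rw [if_pos hbs, Finset.sum_singleton]
        have := hv.pinned b hbs
        push_cast
        linarith
      · rw [if_neg hbs, Finset.sum_empty, sub_zero]
        have hD : D.toFun b = 0 :=
          CpDivisor.apply_eq_zero_of_not_mem (hTb b (bpts_mem (by omega) hj)).1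
            (hTb b (bpts_mem (by omega) hj)).2 hbs
        rw [hD, mul_zero, zero_div, zero_add]
        positivity
  · -- `x₀` strictly inside a piece: order zero, and `D(x₀) = 0`
    have h0 : cpOrder (paramElem D m A t y) x₀ = 0 := by
      have := P.cpOrder_of_mem_Ioo (j := j) (by omega) (y := x₀)
      rw [hPl] at this
      exact this hlt hj2
    rw [h0, add_zero]
    have hx₀p : x₀ < p := hj2.trans_le (bpts_le_p hp1 hTb _)
    have h1x : 1 < x₀ := lt_of_le_of_lt (one_le_bpts hp1 hTb j) hlt
    have : x₀ ∉ suppFinset D := by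
      intro hmem
      exact not_mem_Ioo_bpts hp1 hTb (Or.inl (supp_subset_paramBpts D y hmem)) hj ⟨hlt, hj2⟩
    rw [CpDivisor.apply_eq_zero_of_not_mem h1x hx₀p this]

/-- **Membership**: for admissible parameters the parametrised element lies in `H⁰(D)^{p^m}`.
[cite: ConnesConsani2017ScalingSite, Lemma 5.19 (i)–(iii)] -/
def ParamValid.toLevel (hv : ParamValid D m A t y) : CpH0Level D ((p : ℝ) ^ m) :=
  ⟨paramElem D m A t y, ⟨hv.isCpRational, fun _ hx => hv.divisor_nonneg hx⟩, hv.cpSlopeNorm_le⟩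

end Membership

/-! ### Representation of the level sets by admissible parameters

Every `f ∈ H⁰(D)^{p^m}` is `p^{-m} F_{t,y}` on `[1, p]` for admissible, sorted parameters with the
FIXED sizes `A = bigA D m`, `M = bigM D m` (a priori bounds on the slopes of `p^m f` from
`D + (f) ≥ 0`, `f(p) = f(1)` and `Σ_j h_j (t_{j+1} - t_j) = 0`). -/

section Representation

variable {D : CpDivisor p} {m : ℕ} {f : ℝ → ℝ}

/-- The data attached to an element of `H⁰(D)^{p^m}`: break points based at `1` containing the
support of `D` (Lemma 5.19 (iii)) and the integer slopes `z_j` of `p^m f` (Lemma 5.18 (ii)).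
[cite: ConnesConsani2017ScalingSite, Lemma 5.18 (ii), Lemma 5.19 (iii)] -/
structure RepData (D : CpDivisor p) (m : ℕ) (f : ℝ → ℝ) where
  /-- break points in `(1, p)` -/
  T : Finset ℝ
  hT : ∀ t ∈ T, 1 < t ∧ t < p
  /-- piece data with `lam = bpts p T` -/
  P : CpPieces p f
  hsub : suppFinset D ⊆ T
  hPl : P.lam = bpts p T
  hPn : P.n = T.card
  /-- integer slopes of `p^m f` -/
  z : ℕ → ℤ
  hz : ∀ j, j ≤ T.card → P.h j = (z j : ℝ) / (p : ℝ) ^ m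
  hf : IsCpRational p f
  hH : ∀ x, 0 < x → 0 ≤ D.toFun x + cpOrder f x

/-- Every element of a level set carries representation data.
[cite: ConnesConsani2017ScalingSite, Lemma 5.18 (ii), Prop. 5.15 (iv)] -/
theorem nonempty_repData (F : CpH0Level D ((p : ℝ) ^ m)) : Nonempty (RepData D m F.1) := by
  obtain ⟨T, hT, P, hsub, hPl, hPn, -⟩ :=
    F.2.1.1.exists_cpPieces_base_one hp.out.one_lt (suppFinset D) suppFinset_bound
  choose! z hz using fun j (hj : j ≤ T.card) =>
    P.exists_h_eq_div_pow_of_cpSlopeNorm_le F.2.1.1 hPl hPn hT F.2.2 hj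
  exact ⟨⟨T, hT, P, hsub, hPl, hPn, z, hz, F.2.1.1, F.2.1.2⟩⟩

namespace RepData

variable (R : RepData D m f)

omit hp in
/-- Periodicity `f(px) = f(x)`. [cite: ConnesConsani2017ScalingSite, Prop. 5.2 (i)] -/
theorem hper (R : RepData D m f) : ∀ u, 0 < u → f (p * u) = f u := R.hf.1

/-- `φ_j = z_j + κ(t_j)`, the slope of the convex part. [cite: ConnesConsani2017ScalingSite, Lemma 5.18 (i)] -/
def phi (j : ℕ) : ℤ := R.z j + (kinkUpTo D m (bpts p R.T j) : ℤ)

/-- `D + (f) ≥ 0` at a break point `t_{j+1}`: `z_{j+1} - z_j ≥ -p^m D(t_{j+1})/t_{j+1}`.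
[cite: ConnesConsani2017ScalingSite, Lemma 5.19 (ii)] -/
theorem z_succ_sub_ge {j : ℕ} (hj : j + 1 ≤ R.T.card) :
    -((p : ℝ) ^ m * D.toFun (bpts p R.T (j + 1)) / bpts p R.T (j + 1)) ≤
      (R.z (j + 1) : ℝ) - R.z j := by
  have hpm : (0 : ℝ) < (p : ℝ) ^ m := pow_pos (by exact_mod_cast hp.out.pos) m
  set b := bpts p R.T (j + 1) with hb
  have hb0 : 0 < b := lt_of_lt_of_le one_pos (one_le_bpts hp.out.one_lt R.hT _)
  have h := R.hH b hb0
  have hord : cpOrder f b = b * (R.P.h (j + 1) - R.P.h j) := by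
    have := R.P.cpOrder_lam_succ (j := j) (by rw [R.hPn]; exact hj)
    rwa [R.hPl] at this
  rw [hord, R.hz _ hj, R.hz _ (by omega)] at h
  have key : 0 ≤ (p : ℝ) ^ m * D.toFun b / b + ((R.z (j + 1) : ℝ) - R.z j) := by
    have e : (p : ℝ) ^ m * D.toFun b / b + ((R.z (j + 1) : ℝ) - R.z j) =
        ((p : ℝ) ^ m / b) *
          (D.toFun b + b * ((R.z (j + 1) : ℝ) / (p : ℝ) ^ m - (R.z j : ℝ) / (p : ℝ) ^ m)) := by
      field_simp
    rw [e]
    exact mul_nonneg (div_nonneg hpm.le hb0.le) h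
  linarith

/-- `φ` is non-decreasing. [cite: ConnesConsani2017ScalingSite, Lemma 5.19 (i) (convexity)] -/
theorem phi_le_succ {j : ℕ} (hj : j + 1 ≤ R.T.card) : R.phi j ≤ R.phi (j + 1) := by
  have h1 := R.z_succ_sub_ge hj
  have h2 := kinkUpTo_bpts_succ (D := D) (m := m) R.hT R.hsub hj
  unfold phi
  rw [h2]
  by_cases hbs : bpts p R.T (j + 1) ∈ suppFinset D
  · rw [if_pos hbs]
    have hk : (p : ℝ) ^ m * D.toFun (bpts p R.T (j + 1)) / bpts p R.T (j + 1) ≤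
        kinkWeight D m (bpts p R.T (j + 1)) := Nat.le_ceil _
    have : (R.z j : ℝ) ≤ R.z (j + 1) + kinkWeight D m (bpts p R.T (j + 1)) := by linarith
    have : R.z j ≤ R.z (j + 1) + (kinkWeight D m (bpts p R.T (j + 1)) : ℤ) := by
      exact_mod_cast this
    push_cast
    omega
  · rw [if_neg hbs, add_zero]
    have hb := R.hT (bpts p R.T (j + 1)) (bpts_mem (by omega) hj)
    have hD : D.toFun (bpts p R.T (j + 1)) = 0 :=
      CpDivisor.apply_eq_zero_of_not_mem hb.1 hb.2 hbs
    rw [hD, mul_zero, zero_div, neg_zero, sub_nonneg] at h1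
    have : R.z j ≤ R.z (j + 1) := by exact_mod_cast h1
    omega

/-- `φ` is non-decreasing on `0, …, n` (convexity after translation). [cite: ConnesConsani2017ScalingSite, Lemma 5.19 (i)] -/
theorem phi_mono {i j : ℕ} (hij : i ≤ j) (hj : j ≤ R.T.card) : R.phi i ≤ R.phi j := by
  induction j with
  | zero => rw [Nat.le_zero.1 hij]
  | succ j ih =>
    rcases Nat.lt_or_eq_of_le hij with h | h
    · exact (ih (Nat.lt_succ_iff.1 h) (by omega)).trans (R.phi_le_succ hj)
    · rw [h]

/-- `z_i ≤ z_j + K` for `i ≤ j`. [cite: ConnesConsani2017ScalingSite, Lemma 5.19 (i)] -/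
theorem z_le_add_totalKink {i j : ℕ} (hij : i ≤ j) (hj : j ≤ R.T.card) :
    R.z i ≤ R.z j + totalKink D m := by
  have h := R.phi_mono hij hj
  unfold phi at h
  have h1 := kinkUpTo_le D m (bpts p R.T j)
  have h2 : 0 ≤ kinkUpTo D m (bpts p R.T i) := Nat.zero_le _
  omega

/-- `Σ_j z_j (t_{j+1} - t_j) = 0` (from `f(p) = f(1)`). [cite: ConnesConsani2017ScalingSite, Lemma 6.9, proof ("∫ f dh = 0")] -/
theorem sum_z_mul_eq_zero :
    ∑ j ∈ Finset.range (R.T.card + 1), (R.z j : ℝ) * (bpts p R.T (j + 1) - bpts p R.T j) = 0 := by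
  have hpm : (p : ℝ) ^ m ≠ 0 := pow_ne_zero _ (by exact_mod_cast hp.out.ne_zero)
  have h := R.P.sum_h_mul_eq
  rw [R.P.lam_last, R.hper _ R.P.lam_pos, sub_self, R.hPn] at h
  have e : ∑ j ∈ Finset.range (R.T.card + 1), (R.z j : ℝ) * (bpts p R.T (j + 1) - bpts p R.T j) =
      (p : ℝ) ^ m * ∑ j ∈ Finset.range (R.T.card + 1), R.P.h j * (R.P.lam (j + 1) - R.P.lam j) := by
    rw [Finset.mul_sum]
    refine Finset.sum_congr rfl fun j hj => ?_
    rw [R.hz j (by simpa [Finset.mem_range, Nat.lt_succ_iff] using hj), R.hPl]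
    field_simp
  rw [e, h, mul_zero]

/-- Some slope is `≤ 0` (mean zero). [cite: ConnesConsani2017ScalingSite, Lemma 5.19 (i)] -/
theorem exists_z_nonpos : ∃ j, j ≤ R.T.card ∧ R.z j ≤ 0 := by
  by_contra hcon
  push Not at hcon
  have h0 := R.sum_z_mul_eq_zero
  have hpos : 0 < ∑ j ∈ Finset.range (R.T.card + 1),
      (R.z j : ℝ) * (bpts p R.T (j + 1) - bpts p R.T j) := by
    apply Finset.sum_pos
    · intro j hj
      have hj' : j ≤ R.T.card := by simpa [Finset.mem_range, Nat.lt_succ_iff] using hj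
      exact mul_pos (by exact_mod_cast hcon j hj')
        (sub_pos.2 (bpts_lt_succ hp.out.one_lt R.hT hj'))
    · exact ⟨0, by simp⟩
  linarith

/-- Some slope is `≥ 0` (mean zero). [cite: ConnesConsani2017ScalingSite, Lemma 5.19 (i)] -/
theorem exists_z_nonneg : ∃ j, j ≤ R.T.card ∧ 0 ≤ R.z j := by
  by_contra hcon
  push Not at hcon
  have h0 := R.sum_z_mul_eq_zero
  have hpos : 0 < ∑ j ∈ Finset.range (R.T.card + 1),
      -((R.z j : ℝ) * (bpts p R.T (j + 1) - bpts p R.T j)) := by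
    apply Finset.sum_pos
    · intro j hj
      have hj' : j ≤ R.T.card := by simpa [Finset.mem_range, Nat.lt_succ_iff] using hj
      rw [← neg_mul]
      exact mul_pos (by have := hcon j hj'; exact_mod_cast (by omega : 0 < -R.z j))
        (sub_pos.2 (bpts_lt_succ hp.out.one_lt R.hT hj'))
    · exact ⟨0, by simp⟩
  rw [Finset.sum_neg_distrib] at hpos
  linarith

/-- `z_0 ≤ K`. [cite: ConnesConsani2017ScalingSite, Lemma 5.19 (i)] -/
theorem z_zero_le : R.z 0 ≤ totalKink D m := by
  obtain ⟨j, hj, hz⟩ := R.exists_z_nonpos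
  have := R.z_le_add_totalKink (Nat.zero_le j) hj
  omega

/-- `-K ≤ z_n`. [cite: ConnesConsani2017ScalingSite, Lemma 5.19 (i)] -/
theorem neg_totalKink_le_z_last : -(totalKink D m : ℤ) ≤ R.z R.T.card := by
  obtain ⟨j, hj, hz⟩ := R.exists_z_nonneg
  have := R.z_le_add_totalKink hj le_rfl
  omega

/-- `D + (f) ≥ 0` at `1`: `z_0 - p z_n ≥ -p^m D(1)`. [cite: ConnesConsani2017ScalingSite, Lemma 5.19 (i) ("`-f'₊(1) + p f'₋(p) ≤ N`")] -/
theorem ordOne_ineq : -((p : ℝ) ^ m * D.toFun 1) ≤ (R.z 0 : ℝ) - p * R.z R.T.card := by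
  have hpm : (0 : ℝ) < (p : ℝ) ^ m := pow_pos (by exact_mod_cast hp.out.pos) m
  have h := R.hH 1 one_pos
  have hord : cpOrder f 1 = R.P.h 0 - p * R.P.h R.P.n := by
    have := R.P.cpOrder_lam_zero hp.out.pos R.hper
    rwa [R.hPl, bpts_zero, one_mul] at this
  rw [hord, R.hPn, R.hz 0 (Nat.zero_le _), R.hz _ le_rfl] at h
  have h2 : 0 ≤ (p : ℝ) ^ m * (D.toFun 1 + ((R.z 0 : ℝ) / (p : ℝ) ^ m -
      p * ((R.z R.T.card : ℝ) / (p : ℝ) ^ m))) := mul_nonneg hpm.le h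
  have e : (p : ℝ) ^ m * (D.toFun 1 + ((R.z 0 : ℝ) / (p : ℝ) ^ m -
      p * ((R.z R.T.card : ℝ) / (p : ℝ) ^ m))) =
      (p : ℝ) ^ m * D.toFun 1 + ((R.z 0 : ℝ) - p * R.z R.T.card) := by
    field_simp
  rw [e] at h2
  linarith

/-- `-z_0 ≤ pK + B₁`. [cite: ConnesConsani2017ScalingSite, Lemma 5.19 (i)] -/
theorem neg_z_zero_le : -R.z 0 ≤ ((p * totalKink D m + oneBound D m : ℕ) : ℤ) := by
  have h1 := R.ordOne_ineq
  have h2 : (-(totalKink D m : ℝ)) ≤ R.z R.T.card := by exact_mod_cast R.neg_totalKink_le_z_last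
  have h3 := (abs_le.1 (abs_le_oneBound D m)).2
  have hpR : (0 : ℝ) ≤ p := by positivity
  have h4 : (p : ℝ) * (-(totalKink D m : ℝ)) ≤ p * R.z R.T.card :=
    mul_le_mul_of_nonneg_left h2 hpR
  have : (-(R.z 0) : ℝ) ≤ p * totalKink D m + oneBound D m := by linarith
  exact_mod_cast this

/-- `z_n ≤ K + B₁`. [cite: ConnesConsani2017ScalingSite, Lemma 5.19 (i)] -/
theorem z_last_le : R.z R.T.card ≤ ((totalKink D m + oneBound D m : ℕ) : ℤ) := by
  have h1 := R.ordOne_ineq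
  have h0 := R.z_zero_le
  have h3 := (abs_le.1 (abs_le_oneBound D m)).2
  rcases le_or_gt (R.z R.T.card) 0 with h | h
  · omega
  · have hp1 : (1 : ℝ) ≤ p := by exact_mod_cast hp.out.one_lt.le
    have hzpos : (0 : ℝ) < R.z R.T.card := by exact_mod_cast h
    have h5 : (R.z R.T.card : ℝ) ≤ p * R.z R.T.card := le_mul_of_one_le_left hzpos.le hp1
    have h0' : (R.z 0 : ℝ) ≤ totalKink D m := by exact_mod_cast h0
    have : (R.z R.T.card : ℝ) ≤ totalKink D m + oneBound D m := by linarith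
    exact_mod_cast this

omit hp in
/-- `φ_0 = z_0`. [cite: ConnesConsani2017ScalingSite, Lemma 5.19 (i)] -/
theorem phi_zero : R.phi 0 = R.z 0 := by
  unfold phi
  rw [bpts_zero, kinkUpTo_one]
  simp

/-- `φ_j + A ≥ 0`. [cite: ConnesConsani2017ScalingSite, Lemma 5.19 (i)] -/
theorem phi_add_bigA_nonneg {j : ℕ} (hj : j ≤ R.T.card) : 0 ≤ R.phi j + bigA D m := by
  have h1 := R.phi_mono (Nat.zero_le j) hj
  rw [phi_zero] at h1
  have h2 := R.neg_z_zero_le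
  unfold bigA
  push_cast at h2 ⊢
  omega

/-- `N_j := φ_j + A`, the number of generators `≤ t_j`. [cite: ConnesConsani2017ScalingSite, Lemma 5.19 (iii)] -/
def Ncount (j : ℕ) : ℕ := (R.phi j + bigA D m).toNat

/-- `N_j = φ_j + A` as integers. [cite: ConnesConsani2017ScalingSite, Lemma 5.19 (iii)] -/
theorem Ncount_cast {j : ℕ} (hj : j ≤ R.T.card) : ((R.Ncount j : ℕ) : ℤ) = R.phi j + bigA D m := by
  unfold Ncount
  rw [Int.toNat_of_nonneg (R.phi_add_bigA_nonneg hj)]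

/-- `N` is non-decreasing. [cite: ConnesConsani2017ScalingSite, Lemma 5.19 (iii)] -/
theorem Ncount_mono {i j : ℕ} (hij : i ≤ j) (hj : j ≤ R.T.card) : R.Ncount i ≤ R.Ncount j := by
  have := R.phi_mono hij hj
  have h1 := R.Ncount_cast (hij.trans hj)
  have h2 := R.Ncount_cast hj
  omega

/-- `N_n ≤ M`. [cite: ConnesConsani2017ScalingSite, Lemma 5.19 (iii)] -/
theorem Ncount_last_le : R.Ncount R.T.card ≤ bigM D m := by
  have h1 := R.Ncount_cast le_rfl
  unfold phi at h1
  have h2 := R.z_last_le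
  have h3 := kinkUpTo_le D m (bpts p R.T R.T.card)
  unfold bigM
  push_cast at h2
  omega

/-- `N_j ≤ M`. [cite: ConnesConsani2017ScalingSite, Lemma 5.19 (iii)] -/
theorem Ncount_le_bigM {j : ℕ} (hj : j ≤ R.T.card) : R.Ncount j ≤ bigM D m :=
  (R.Ncount_mono hj le_rfl).trans R.Ncount_last_le

omit hp in
/-- Search predicate for `y_σ`. [cite: ConnesConsani2017ScalingSite, Lemma 5.19 (iii)] -/
theorem exists_lt_Ncount {σ : ℕ} (hσ : σ < R.Ncount R.T.card) : ∃ j, σ < R.Ncount j := ⟨_, hσ⟩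

/-- **The sorted parameters `y_σ`** of an element: `y_σ = t_j` for `N_{j-1} ≤ σ < N_j`, and
`y_σ = p` for `σ ≥ N_n`. [cite: ConnesConsani2017ScalingSite, Lemma 5.19 (iii)] -/
def yOf (σ : Fin (bigM D m)) : ℝ :=
  if hσ : (σ : ℕ) < R.Ncount R.T.card then bpts p R.T (Nat.find (R.exists_lt_Ncount hσ)) else p

omit hp in
/-- The index of `y_σ` is `≤ n`. [cite: ConnesConsani2017ScalingSite, Lemma 5.19 (iii)] -/
theorem find_le {σ : ℕ} (hσ : σ < R.Ncount R.T.card) :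
    Nat.find (R.exists_lt_Ncount hσ) ≤ R.T.card := Nat.find_min' _ hσ

/-- `y_σ ≤ t_j ↔ σ < N_j`. [cite: ConnesConsani2017ScalingSite, Lemma 5.19 (iii)] -/
theorem yOf_le_iff {j : ℕ} (hj : j ≤ R.T.card) (σ : Fin (bigM D m)) :
    R.yOf σ ≤ bpts p R.T j ↔ (σ : ℕ) < R.Ncount j := by
  have hp1 := hp.out.one_lt
  unfold yOf
  split_ifs with hσ
  · constructor
    · intro h
      have hfj : Nat.find (R.exists_lt_Ncount hσ) ≤ j := by
        by_contra hcon
        push Not at hcon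
        exact absurd h (not_le.2 (bpts_lt_of_lt hp1 R.hT hcon (by have := R.find_le hσ; omega)))
      exact lt_of_lt_of_le (Nat.find_spec (R.exists_lt_Ncount hσ)) (R.Ncount_mono hfj hj)
    · intro h
      have hfj : Nat.find (R.exists_lt_Ncount hσ) ≤ j := Nat.find_min' _ h
      exact bpts_le_of_le hp1 R.hT hfj (by omega)
  · constructor
    · intro h
      exact absurd h (not_le.2 (bpts_lt_p hp1 R.hT hj))
    · intro h
      exact absurd (lt_of_lt_of_le h (R.Ncount_mono hj le_rfl)) hσ

/-- `#{σ | y_σ ≤ t_j} = N_j`. [cite: ConnesConsani2017ScalingSite, Lemma 5.19 (iii)] -/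
theorem card_yOf_le {j : ℕ} (hj : j ≤ R.T.card) :
    (Finset.univ.filter fun σ => R.yOf σ ≤ bpts p R.T j).card = R.Ncount j := by
  rw [← card_filter_val_lt (R.Ncount_le_bigM hj)]
  congr 1
  ext σ
  simp only [Finset.mem_filter, Finset.mem_univ, true_and]
  exact R.yOf_le_iff hj σ

omit hp in
/-- The values of `y`. [cite: ConnesConsani2017ScalingSite, Lemma 5.19 (iii)] -/
theorem yOf_cases (σ : Fin (bigM D m)) :
    (∃ i, i ≤ R.T.card ∧ R.yOf σ = bpts p R.T i) ∨ R.yOf σ = p := by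
  unfold yOf
  split_ifs with hσ
  · exact Or.inl ⟨_, R.find_le hσ, rfl⟩
  · exact Or.inr rfl

/-- `1 ≤ y_σ`. [cite: ConnesConsani2017ScalingSite, Lemma 5.19 (iii)] -/
theorem one_le_yOf (σ : Fin (bigM D m)) : 1 ≤ R.yOf σ := by
  rcases R.yOf_cases σ with ⟨i, -, h⟩ | h
  · rw [h]; exact one_le_bpts hp.out.one_lt R.hT i
  · rw [h]; exact_mod_cast hp.out.one_lt.le

/-- `y_σ ≤ p`. [cite: ConnesConsani2017ScalingSite, Lemma 5.19 (iii)] -/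
theorem yOf_le_p (σ : Fin (bigM D m)) : R.yOf σ ≤ p := by
  rcases R.yOf_cases σ with ⟨i, -, h⟩ | h
  · rw [h]; exact bpts_le_p hp.out.one_lt R.hT i
  · rw [h]

/-- No `y_σ` strictly inside a piece. [cite: ConnesConsani2017ScalingSite, Lemma 5.19 (iii)] -/
theorem yOf_le_or_ge {j : ℕ} (hj : j ≤ R.T.card) (σ : Fin (bigM D m)) :
    R.yOf σ ≤ bpts p R.T j ∨ bpts p R.T (j + 1) ≤ R.yOf σ := by
  have hp1 := hp.out.one_lt
  rcases R.yOf_cases σ with ⟨i, hi, h⟩ | h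
  · rw [h]
    rcases le_or_gt i j with hij | hij
    · exact Or.inl (bpts_le_of_le hp1 R.hT hij (by omega))
    · exact Or.inr (bpts_le_of_le hp1 R.hT (by omega) (by omega))
  · rw [h]; exact Or.inr (bpts_le_p hp1 R.hT _)

/-- No support point strictly inside a piece. [cite: ConnesConsani2017ScalingSite, Lemma 5.19 (iii)] -/
theorem supp_le_or_ge' {j : ℕ} (hj : j ≤ R.T.card) {μ : ℝ} (hμ : μ ∈ suppFinset D) :
    μ ≤ bpts p R.T j ∨ bpts p R.T (j + 1) ≤ μ := by
  have := not_mem_Ioo_bpts hp.out.one_lt R.hT (Or.inl (R.hsub hμ)) hj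
  by_contra h
  push Not at h
  exact this ⟨h.1, h.2⟩

/-- The slopes of `F_{t,y}` are the `z_j`. [cite: ConnesConsani2017ScalingSite, Lemma 5.19 (iii)] -/
theorem slopeAt_yOf {j : ℕ} (hj : j ≤ R.T.card) :
    slopeAt D m (bigA D m) R.yOf (bpts p R.T j) = R.z j := by
  have h1 := R.card_yOf_le hj
  have h2 := R.Ncount_cast hj
  unfold slopeAt
  rw [h1]
  unfold phi kinkUpTo at h2
  push_cast at h2 ⊢
  linarith

/-- **Monotone parameters.** [cite: ConnesConsani2017ScalingSite, Lemma 5.19 (iii)] -/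
theorem monotone_yOf : Monotone R.yOf := by
  intro σ σ' hle
  rcases R.yOf_cases σ' with ⟨i, hi, h⟩ | h
  · have h1 : (σ' : ℕ) < R.Ncount i := (R.yOf_le_iff hi σ').1 h.le
    have h2 : (σ : ℕ) < R.Ncount i := lt_of_le_of_lt (Fin.le_def.1 hle) h1
    rw [h]
    exact (R.yOf_le_iff hi σ).2 h2
  · rw [h]; exact R.yOf_le_p σ

/-- **The representation at break points.** [cite: ConnesConsani2017ScalingSite, Lemma 5.19 (iii)] -/
theorem eq_paramFun_bpts {j : ℕ} (hj : j ≤ R.T.card + 1) :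
    (p : ℝ) ^ m * f (bpts p R.T j) =
      paramFun D m (bigA D m) ((p : ℝ) ^ m * f 1) R.yOf (bpts p R.T j) := by
  induction j with
  | zero => rw [bpts_zero, paramFun_one D m _ _ R.one_le_yOf]
  | succ j ih =>
    have hj' : j ≤ R.T.card := by omega
    have hstep : f (bpts p R.T (j + 1)) =
        f (bpts p R.T j) + R.P.h j * (bpts p R.T (j + 1) - bpts p R.T j) := by
      have := R.P.f_lam_succ (j := j) (by rw [R.hPn]; exact hj')
      rwa [R.hPl] at this
    rw [hstep, mul_add, ih (by omega), R.hz j hj',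
      paramFun_affine D m (bigA D m) _ R.yOf (R.yOf_le_or_ge hj') (fun μ hμ => R.supp_le_or_ge' hj' hμ)
        (bpts_lt_succ hp.out.one_lt R.hT hj').le le_rfl, R.slopeAt_yOf hj']
    have hpm : (p : ℝ) ^ m ≠ 0 := pow_ne_zero _ (by exact_mod_cast hp.out.ne_zero)
    field_simp

/-- **The representation on `[1, p]`**: `p^m f = F_{t,y}` with `t = p^m f(1)`.
[cite: ConnesConsani2017ScalingSite, Lemma 5.19 (iii)] -/
theorem eq_paramFun {x : ℝ} (hx : x ∈ Icc (1 : ℝ) p) :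
    (p : ℝ) ^ m * f x = paramFun D m (bigA D m) ((p : ℝ) ^ m * f 1) R.yOf x := by
  have hp1 := hp.out.one_lt
  rcases hx.2.eq_or_lt with h | h
  · have hx' : x = bpts p R.T (R.T.card + 1) := by
      rw [bpts_of_card_lt (Nat.lt_succ_self _)]; exact h
    rw [hx']
    exact R.eq_paramFun_bpts le_rfl
  · obtain ⟨j, hj, hj1, hj2⟩ := exists_bpts_piece_right (T := R.T) hx.1 h
    have hpiece : f x = f (bpts p R.T j) + R.P.h j * (x - bpts p R.T j) := by
      have := R.P.piece j (by rw [R.hPn]; exact hj) x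
      rw [R.hPl] at this
      exact this hj1 hj2.le
    rw [hpiece, mul_add, R.eq_paramFun_bpts (by omega), R.hz j hj,
      paramFun_affine D m (bigA D m) _ R.yOf (R.yOf_le_or_ge hj) (fun μ hμ => R.supp_le_or_ge' hj hμ)
        hj1 hj2.le, R.slopeAt_yOf hj]
    have hpm : (p : ℝ) ^ m ≠ 0 := pow_ne_zero _ (by exact_mod_cast hp.out.ne_zero)
    field_simp

/-- `#{σ | y_σ = t_{j+1}} = N_{j+1} - N_j`. [cite: ConnesConsani2017ScalingSite, Lemma 5.19 (iii)] -/
theorem card_yOf_eq {j : ℕ} (hj : j + 1 ≤ R.T.card) :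
    ((Finset.univ.filter fun σ => R.yOf σ = bpts p R.T (j + 1)).card : ℤ) =
      R.phi (j + 1) - R.phi j := by
  have hab : bpts p R.T j < bpts p R.T (j + 1) := bpts_lt_succ hp.out.one_lt R.hT (by omega)
  have hsub : (Finset.univ.filter fun σ => R.yOf σ ≤ bpts p R.T j) ⊆
      Finset.univ.filter fun σ => R.yOf σ ≤ bpts p R.T (j + 1) := by
    intro σ
    simp only [Finset.mem_filter, Finset.mem_univ, true_and]
    exact fun h => h.trans hab.le
  have heq : (Finset.univ.filter fun σ => R.yOf σ = bpts p R.T (j + 1)) =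
      (Finset.univ.filter fun σ => R.yOf σ ≤ bpts p R.T (j + 1)) \
        Finset.univ.filter fun σ => R.yOf σ ≤ bpts p R.T j := by
    ext σ
    simp only [Finset.mem_sdiff, Finset.mem_filter, Finset.mem_univ, true_and, not_le]
    constructor
    · intro h; rw [h]; exact ⟨le_rfl, hab⟩
    · rintro ⟨h1, h2⟩
      rcases R.yOf_le_or_ge (j := j) (by omega) σ with h | h
      · exact absurd h2 (not_lt.2 h)
      · exact le_antisymm h1 h
  rw [heq, Finset.card_sdiff_of_subset hsub, R.card_yOf_le hj, R.card_yOf_le (by omega)]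
  have hmono := R.Ncount_mono (Nat.le_succ j) hj
  rw [Nat.cast_sub hmono, R.Ncount_cast hj, R.Ncount_cast (by omega)]
  ring

/-- **Admissibility of the parameters of an element.** [cite: ConnesConsani2017ScalingSite, Lemma 5.19 (i)–(iii)] -/
theorem paramValid : ParamValid D m (bigA D m) ((p : ℝ) ^ m * f 1) R.yOf where
  one_le := R.one_le_yOf
  le_p := R.yOf_le_p
  pinned := by
    intro μ hμ
    obtain ⟨i, hi1, hi2, hiμ⟩ := exists_bpts_eq (p := p) (R.hsub hμ)
    obtain ⟨j, rfl⟩ : ∃ j, i = j + 1 := ⟨i - 1, by omega⟩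
    have hμ' : bpts p R.T (j + 1) ∈ suppFinset D := by rw [hiμ]; exact hμ
    have h1 := R.card_yOf_eq hi2
    have h2 := R.z_succ_sub_ge hi2
    have h3 := kinkUpTo_bpts_succ (D := D) (m := m) R.hT R.hsub hi2
    rw [if_pos hμ'] at h3
    have h4 : ((Finset.univ.filter fun σ => R.yOf σ = bpts p R.T (j + 1)).card : ℝ) =
        ((R.z (j + 1) : ℝ) - R.z j) + kinkWeight D m (bpts p R.T (j + 1)) := by
      have : ((Finset.univ.filter fun σ => R.yOf σ = bpts p R.T (j + 1)).card : ℤ) =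
          (R.z (j + 1) - R.z j) + kinkWeight D m (bpts p R.T (j + 1)) := by
        rw [h1]; unfold phi; rw [h3]; push_cast; ring
      exact_mod_cast this
    subst hiμ
    rw [h4]
    linarith
  clos := by
    have hp1 := hp.out.one_lt
    have hpR : (1 : ℝ) ≤ p := by exact_mod_cast hp1.le
    rw [← R.eq_paramFun ⟨hpR, le_rfl⟩, ← R.eq_paramFun ⟨le_rfl, hpR⟩]
    have := R.hper 1 one_pos
    rw [mul_one] at this
    rw [this]
  ordOne := by
    have h1 := R.slopeAt_yOf (Nat.zero_le _)
    rw [bpts_zero, slopeAt_one R.one_le_yOf] at h1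
    have h2 := R.slopeAt_yOf (le_refl R.T.card)
    have hlast : (Finset.univ.filter fun σ => R.yOf σ ≤ bpts p R.T R.T.card) =
        Finset.univ.filter fun σ => R.yOf σ < p := by
      ext σ
      simp only [Finset.mem_filter, Finset.mem_univ, true_and]
      constructor
      · exact fun h => h.trans_lt (bpts_lt_p hp.out.one_lt R.hT le_rfl)
      · intro h
        rcases R.yOf_cases σ with ⟨i, hi, hy⟩ | hy
        · rw [hy]; exact bpts_le_of_le hp.out.one_lt R.hT hi (by omega)
        · exact absurd hy h.ne
    have hK : (suppFinset D).filter (fun μ => μ ≤ bpts p R.T R.T.card) = suppFinset D := by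
      ext μ
      simp only [Finset.mem_filter, and_iff_left_iff_imp]
      intro hμ
      obtain ⟨i, -, hi2, hiμ⟩ := exists_bpts_eq (p := p) (R.hsub hμ)
      rw [← hiμ]
      exact bpts_le_of_le hp.out.one_lt R.hT hi2 (by omega)
    unfold slopeAt at h2
    rw [hlast, hK] at h2
    have h3 := R.ordOne_ineq
    have h1' : (-(bigA D m : ℝ) + (Finset.univ.filter fun σ => R.yOf σ = 1).card) = R.z 0 := by
      exact_mod_cast h1
    have h2' : (-(bigA D m : ℝ) + (Finset.univ.filter fun σ => R.yOf σ < p).card -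
        totalKink D m) = R.z R.T.card := by
      unfold totalKink
      exact_mod_cast h2
    rw [h1', h2']
    exact h3

end RepData

/-- **Representation theorem**: every `f ∈ H⁰(D)^{p^m}` is `p^{-m} F_{t,y}` on `[1, p]` for
monotone admissible parameters of the fixed sizes `A = bigA D m`, `M = bigM D m`, `t = p^m f(1)`.
[cite: ConnesConsani2017ScalingSite, Lemma 5.19 (iii)] -/
theorem exists_paramValid (F : CpH0Level D ((p : ℝ) ^ m)) :
    ∃ y : Fin (bigM D m) → ℝ, Monotone y ∧ ParamValid D m (bigA D m) ((p : ℝ) ^ m * F.1 1) y ∧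
      ∀ x ∈ Icc (1 : ℝ) p, (p : ℝ) ^ m * F.1 x = paramFun D m (bigA D m) ((p : ℝ) ^ m * F.1 1) y x := by
  obtain ⟨R⟩ := nonempty_repData F
  exact ⟨R.yOf, R.monotone_yOf, R.paramValid, fun x hx => R.eq_paramFun hx⟩

end Representation

end Param

end Literature.NumberTheory.ConnesConsani
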